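import Summits.AtomisticToContinuum.HydrodynamicLimit.Theorems.CollisionIsometryCLTAdaptedWeightCLTBHContactToMassModulus

/-!
# Stub `stub_contactToMass` (S4) of the line `block-h-dissipation-closure`, helper file 7: the modulus of the
normalised Hellinger dissipation through the LOSS DISTANCE, real form
(crux `CollisionIsometryCLT.AdaptedWeightCLT`, stmt-AtomisticToContinuum-14868; `--supports`, anchor
`bhContactToMass_modulusLoss_anchor`)

Step (a) of the repair plan of `stub_contactToMass`, first half: the Hölder-`½` modulus of helper file 6
(`…BHContactToMassModulus`, lower Lebesgue integrals) turned into an inequality between the real numbers the line's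
functionals are made of. Write `𝒩(f) = ∫ B (√(f′f′_*) − √(f f_*))²` (`hellNum`, so `hellDiss f = (2 Z(f))⁻¹ 𝒩(f)`) and
`D(f₁,f₂) = ∫ B (√(f₁f₁_*) − √(f₂f₂_*))²` (`lossDist`); the objects of the second half are also declared here (`fluxL1`, the
flux-weighted `L¹` distance, and `sphereArea = |S²|`). For measurable `f₁, f₂ ≥ 0` with `B fᵢ fᵢ_*` integrable:
* `integrable_hellNum_integrand`, `integrable_lossDist_integrand` (domination by `B(f′f′_* + f f_*)`, `B(f₁f₁_* + f₂f₂_*)`);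
* `hellNum_le` — `𝒩 ≤ 2Z`; `hellNum_eq` — `𝒩(f) = 2 Z(f) 𝒟h(f)` (also when `Z(f) = 0`);
* `sqrt_hellNum_le` — `√𝒩(f₁) ≤ √𝒩(f₂) + 2 √D(f₁,f₂)` (the landed `sqrt_lintegral_hellNum_le`, made real);
* `hellDiss_sub_le_of_lossDist` — **`𝒟h(f₁) − 𝒟h(f₂) ≤ (|Z(f₂) − Z(f₁)| + 2√(2 D Z(f₂)) + 2D) / Z(f₁)`** when
  `Z(f₁) > 0` (square the triangle inequality, `𝒩₂ = 2Z₂𝒟h₂ ≤ 2Z₂`, `𝒟h₂ ≤ 1`).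
The second half (`…BHContactToMassModulusReal`) bounds `D` and `|Z(f₁) − Z(f₂)|` by a flux-weighted `L¹` distance.
-/

namespace Summit.AtomisticToContinuum.HydrodynamicLimit.Theorems.BlockHDissipation

open scoped BigOperators Topology Classical MeasureTheory ENNReal InnerProductSpace
open Filter Set MeasureTheory
open Literature.Analysis.FluidPDE
open Summit.AtomisticToContinuum.HydrodynamicLimit.Theorems.ContactSourceDuhamel (T3 V3 Cfg Vel Flow Flows)
open Literature.MathematicalPhysics.KineticTheory (collide hardSphereKernel sphereMeasure)

noncomputable section

namespace ContactToMass

/-! ## Objects -/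

/-- The Hellinger NUMERATOR `𝒩(f) = ∫ B (√(f′f′_*) − √(f f_*))²` (`hellDiss f = (2 Z(f))⁻¹ 𝒩(f)`). -/
def hellNum (f : V3 → ℝ) : ℝ :=
  ∫ q : PairDir, hardSphereKernel q.1 q.2 *
    (Real.sqrt (f (collide q.2 q.1).1 * f (collide q.2 q.1).2) - Real.sqrt (f q.1.1 * f q.1.2)) ^ 2 ∂pairDirMeasure

/-- The LOSS DISTANCE `D(f₁, f₂) = ∫ B (√(f₁f₁_*) − √(f₂f₂_*))²` of two velocity laws. -/
def lossDist (f₁ f₂ : V3 → ℝ) : ℝ :=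
  ∫ q : PairDir, hardSphereKernel q.1 q.2 *
    (Real.sqrt (f₁ q.1.1 * f₁ q.1.2) - Real.sqrt (f₂ q.1.1 * f₂ q.1.2)) ^ 2 ∂pairDirMeasure

/-- `hellDiss` through its numerator. -/
theorem hellDiss_eq_hellNum (f : V3 → ℝ) : hellDiss f = (2 * fluxZ f)⁻¹ * hellNum f := rfl

/-- The FLUX-WEIGHTED `L¹` DISTANCE of two velocity laws about the reference velocity `u`:
`∫‖·−u‖Δ · ∫f₁ + ∫Δ · ∫‖·−u‖f₁ + ∫‖·−u‖f₂ · ∫Δ + ∫f₂ · ∫‖·−u‖Δ`, `Δ = |f₁ − f₂|`. -/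
def fluxL1 (u : V3) (f₁ f₂ : V3 → ℝ) : ℝ :=
  (∫ v, ‖v - u‖ * |f₁ v - f₂ v|) * (∫ v, f₁ v) + (∫ v, |f₁ v - f₂ v|) * (∫ v, ‖v - u‖ * f₁ v) +
    (∫ v, ‖v - u‖ * f₂ v) * (∫ v, |f₁ v - f₂ v|) + (∫ v, f₂ v) * (∫ v, ‖v - u‖ * |f₁ v - f₂ v|)

/-- The surface of the unit sphere `|S²| = sphereMeasure(S²)` as a real number. -/
def sphereArea : ℝ := (sphereMeasure (Set.univ : Set (Metric.sphere (0 : V3) 1))).toReal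

/-- `|S²| ≥ 0`. -/
theorem sphereArea_nonneg : 0 ≤ sphereArea := ENNReal.toReal_nonneg

/-- `|S²|` as an extended real is the sphere measure of the sphere. -/
theorem ofReal_sphereArea : ENNReal.ofReal sphereArea = sphereMeasure (Set.univ : Set (Metric.sphere (0 : V3) 1)) := by
  haveI := isFiniteMeasure_sphereMeasure (E := V3)
  exact ENNReal.ofReal_toReal (measure_ne_top _ _)

variable {f f₁ f₂ : V3 → ℝ}

/-! ## Integrability of the numerator and of the loss distance -/

/-- `(√a − √b)² ≤ a + b` for `a, b ≥ 0`. -/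
theorem sq_sqrt_sub_sqrt_le_add {a b : ℝ} (ha : 0 ≤ a) (hb : 0 ≤ b) : (Real.sqrt a - Real.sqrt b) ^ 2 ≤ a + b := by
  have h1 := Real.sq_sqrt ha
  have h2 := Real.sq_sqrt hb
  nlinarith [Real.sqrt_nonneg a, Real.sqrt_nonneg b, mul_nonneg (Real.sqrt_nonneg a) (Real.sqrt_nonneg b)]

/-- The numerator integrand is integrable when `B f f_*` is (dominated by `B (f′f′_* + f f_*)`). -/
theorem integrable_hellNum_integrand (hf : Measurable f) (hf0 : ∀ v, 0 ≤ f v)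
    (hint : Integrable (fun q : PairDir => hardSphereKernel q.1 q.2 * (f q.1.1 * f q.1.2)) pairDirMeasure) :
    Integrable (fun q : PairDir => hardSphereKernel q.1 q.2 *
      (Real.sqrt (f (collide q.2 q.1).1 * f (collide q.2 q.1).2) - Real.sqrt (f q.1.1 * f q.1.2)) ^ 2) pairDirMeasure := by
  have hdom : Integrable (fun q : PairDir => hardSphereKernel q.1 q.2 * (f (collide q.2 q.1).1 * f (collide q.2 q.1).2) +
      hardSphereKernel q.1 q.2 * (f q.1.1 * f q.1.2)) pairDirMeasure :=
    (DVTransfer.integrable_kernel_mul_pair_collide hint).add hint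
  have hc : Measurable fun q : PairDir => collide q.2 q.1 := continuous_collide_uncurry.measurable
  refine hdom.mono' ?_ (Eventually.of_forall fun q => ?_)
  · exact (DVTransfer.continuous_hardSphereKernel_pairDir.measurable.mul
      ((((hf.comp (measurable_fst.comp hc)).mul (hf.comp (measurable_snd.comp hc))).sqrt.sub
        ((hf.comp (measurable_fst.comp measurable_fst)).mul (hf.comp (measurable_snd.comp measurable_fst))).sqrt).pow_const 2)).aestronglyMeasurable
  · have hB : 0 ≤ hardSphereKernel q.1 q.2 := le_max_right _ _
    have ha : 0 ≤ f (collide q.2 q.1).1 * f (collide q.2 q.1).2 := mul_nonneg (hf0 _) (hf0 _)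
    have hb : 0 ≤ f q.1.1 * f q.1.2 := mul_nonneg (hf0 _) (hf0 _)
    rw [Real.norm_eq_abs, abs_of_nonneg (mul_nonneg hB (sq_nonneg _)), ← mul_add]
    exact mul_le_mul_of_nonneg_left (sq_sqrt_sub_sqrt_le_add ha hb) hB

/-- The loss-distance integrand is integrable when `B f₁f₁_*` and `B f₂f₂_*` are. -/
theorem integrable_lossDist_integrand (hf₁ : Measurable f₁) (hf₂ : Measurable f₂) (h₁ : ∀ v, 0 ≤ f₁ v)
    (h₂ : ∀ v, 0 ≤ f₂ v)
    (hint₁ : Integrable (fun q : PairDir => hardSphereKernel q.1 q.2 * (f₁ q.1.1 * f₁ q.1.2)) pairDirMeasure)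
    (hint₂ : Integrable (fun q : PairDir => hardSphereKernel q.1 q.2 * (f₂ q.1.1 * f₂ q.1.2)) pairDirMeasure) :
    Integrable (fun q : PairDir => hardSphereKernel q.1 q.2 *
      (Real.sqrt (f₁ q.1.1 * f₁ q.1.2) - Real.sqrt (f₂ q.1.1 * f₂ q.1.2)) ^ 2) pairDirMeasure := by
  have hdom : Integrable (fun q : PairDir => hardSphereKernel q.1 q.2 * (f₁ q.1.1 * f₁ q.1.2) +
      hardSphereKernel q.1 q.2 * (f₂ q.1.1 * f₂ q.1.2)) pairDirMeasure := hint₁.add hint₂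
  refine hdom.mono' ?_ (Eventually.of_forall fun q => ?_)
  · exact (DVTransfer.continuous_hardSphereKernel_pairDir.measurable.mul
      ((((hf₁.comp (measurable_fst.comp measurable_fst)).mul (hf₁.comp (measurable_snd.comp measurable_fst))).sqrt.sub
        ((hf₂.comp (measurable_fst.comp measurable_fst)).mul (hf₂.comp (measurable_snd.comp measurable_fst))).sqrt).pow_const 2)).aestronglyMeasurable
  · have hB : 0 ≤ hardSphereKernel q.1 q.2 := le_max_right _ _
    have ha : 0 ≤ f₁ q.1.1 * f₁ q.1.2 := mul_nonneg (h₁ _) (h₁ _)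
    have hb : 0 ≤ f₂ q.1.1 * f₂ q.1.2 := mul_nonneg (h₂ _) (h₂ _)
    rw [Real.norm_eq_abs, abs_of_nonneg (mul_nonneg hB (sq_nonneg _)), ← mul_add]
    exact mul_le_mul_of_nonneg_left (sq_sqrt_sub_sqrt_le_add ha hb) hB

/-- `𝒩(f) ≥ 0`. -/
theorem hellNum_nonneg (f : V3 → ℝ) : 0 ≤ hellNum f :=
  integral_nonneg fun _ => mul_nonneg (le_max_right _ _) (sq_nonneg _)

/-- `D(f₁, f₂) ≥ 0`. -/
theorem lossDist_nonneg (f₁ f₂ : V3 → ℝ) : 0 ≤ lossDist f₁ f₂ :=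
  integral_nonneg fun _ => mul_nonneg (le_max_right _ _) (sq_nonneg _)

/-- **`𝒩(f) ≤ 2 Z(f)`** (the Hellinger expansion `𝒩 = 2Z − 2∫B√(f f_* f′f′_*)` with a nonnegative cross term). -/
theorem hellNum_le (hf : Measurable f) (hf0 : ∀ v, 0 ≤ f v)
    (hint : Integrable (fun q : PairDir => hardSphereKernel q.1 q.2 * (f q.1.1 * f q.1.2)) pairDirMeasure) :
    hellNum f ≤ 2 * fluxZ f := by
  rw [hellNum, DVTransfer.integral_hellingerSq_eq hf hf0 hint]
  have hI : 0 ≤ ∫ q : PairDir, hardSphereKernel q.1 q.2 *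
      Real.sqrt (f q.1.1 * f q.1.2 * (f (collide q.2 q.1).1 * f (collide q.2 q.1).2)) ∂pairDirMeasure :=
    integral_nonneg fun q => mul_nonneg (le_max_right _ _) (Real.sqrt_nonneg _)
  linarith

/-- **`𝒩(f) = 2 Z(f) 𝒟h(f)`**, also in the degenerate case `Z(f) = 0` (then `𝒩(f) = 0` by `𝒩 ≤ 2Z`). -/
theorem hellNum_eq (hf : Measurable f) (hf0 : ∀ v, 0 ≤ f v)
    (hint : Integrable (fun q : PairDir => hardSphereKernel q.1 q.2 * (f q.1.1 * f q.1.2)) pairDirMeasure) :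
    hellNum f = 2 * fluxZ f * hellDiss f := by
  by_cases hZ : fluxZ f = 0
  · have h1 := hellNum_le hf hf0 hint
    rw [hZ, mul_zero] at h1
    rw [hZ, mul_zero, zero_mul]
    exact le_antisymm h1 (hellNum_nonneg f)
  · rw [hellDiss_eq_hellNum, ← mul_assoc, mul_inv_cancel₀ (mul_ne_zero two_ne_zero hZ), one_mul]

/-! ## The triangle inequality, real form -/

/-- **`√𝒩(f₁) ≤ √𝒩(f₂) + 2 √D(f₁, f₂)`** for measurable `f₁, f₂ ≥ 0` with `B fᵢfᵢ_*` integrable. -/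
theorem sqrt_hellNum_le (hf₁ : Measurable f₁) (hf₂ : Measurable f₂) (h₁ : ∀ v, 0 ≤ f₁ v) (h₂ : ∀ v, 0 ≤ f₂ v)
    (hint₁ : Integrable (fun q : PairDir => hardSphereKernel q.1 q.2 * (f₁ q.1.1 * f₁ q.1.2)) pairDirMeasure)
    (hint₂ : Integrable (fun q : PairDir => hardSphereKernel q.1 q.2 * (f₂ q.1.1 * f₂ q.1.2)) pairDirMeasure) :
    Real.sqrt (hellNum f₁) ≤ Real.sqrt (hellNum f₂) + 2 * Real.sqrt (lossDist f₁ f₂) := by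
  have key := sqrt_lintegral_hellNum_le hf₁ hf₂
  have e₁ : (∫⁻ q : PairDir, ENNReal.ofReal (hardSphereKernel q.1 q.2 *
      (Real.sqrt (f₁ (collide q.2 q.1).1 * f₁ (collide q.2 q.1).2) - Real.sqrt (f₁ q.1.1 * f₁ q.1.2)) ^ 2)
      ∂pairDirMeasure) = ENNReal.ofReal (hellNum f₁) :=
    (ofReal_integral_eq_lintegral_ofReal (integrable_hellNum_integrand hf₁ h₁ hint₁)
      (Eventually.of_forall fun q => mul_nonneg (le_max_right _ _) (sq_nonneg _))).symm
  have e₂ : (∫⁻ q : PairDir, ENNReal.ofReal (hardSphereKernel q.1 q.2 *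
      (Real.sqrt (f₂ (collide q.2 q.1).1 * f₂ (collide q.2 q.1).2) - Real.sqrt (f₂ q.1.1 * f₂ q.1.2)) ^ 2)
      ∂pairDirMeasure) = ENNReal.ofReal (hellNum f₂) :=
    (ofReal_integral_eq_lintegral_ofReal (integrable_hellNum_integrand hf₂ h₂ hint₂)
      (Eventually.of_forall fun q => mul_nonneg (le_max_right _ _) (sq_nonneg _))).symm
  have eD : (∫⁻ q : PairDir, ENNReal.ofReal (hardSphereKernel q.1 q.2 *
      (Real.sqrt (f₁ q.1.1 * f₁ q.1.2) - Real.sqrt (f₂ q.1.1 * f₂ q.1.2)) ^ 2) ∂pairDirMeasure) =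
      ENNReal.ofReal (lossDist f₁ f₂) :=
    (ofReal_integral_eq_lintegral_ofReal (integrable_lossDist_integrand hf₁ hf₂ h₁ h₂ hint₁ hint₂)
      (Eventually.of_forall fun q => mul_nonneg (le_max_right _ _) (sq_nonneg _))).symm
  rw [e₁, e₂, eD] at key
  have hhalf : (0 : ℝ) ≤ 1 / 2 := by norm_num
  rw [ENNReal.ofReal_rpow_of_nonneg (hellNum_nonneg f₁) hhalf, ENNReal.ofReal_rpow_of_nonneg (hellNum_nonneg f₂) hhalf,
    ENNReal.ofReal_rpow_of_nonneg (lossDist_nonneg f₁ f₂) hhalf, ← Real.sqrt_eq_rpow, ← Real.sqrt_eq_rpow,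
    ← Real.sqrt_eq_rpow] at key
  have h2 : (2 : ℝ≥0∞) * ENNReal.ofReal (Real.sqrt (lossDist f₁ f₂)) = ENNReal.ofReal (2 * Real.sqrt (lossDist f₁ f₂)) := by
    rw [ENNReal.ofReal_mul (by norm_num : (0 : ℝ) ≤ 2), ENNReal.ofReal_ofNat]
  rw [h2, ← ENNReal.ofReal_add (Real.sqrt_nonneg _) (by positivity)] at key
  exact (ENNReal.ofReal_le_ofReal_iff (by positivity)).1 key

/-- **One-sided modulus through the loss distance**: for measurable `f₁, f₂ ≥ 0` with `B fᵢfᵢ_*` integrable and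
`Z(f₁) > 0`, `𝒟h(f₁) − 𝒟h(f₂) ≤ (|Z(f₂) − Z(f₁)| + 2 √(2 D Z(f₂)) + 2 D) / Z(f₁)`, `D = D(f₁, f₂)`. -/
theorem hellDiss_sub_le_of_lossDist (hf₁ : Measurable f₁) (hf₂ : Measurable f₂) (h₁ : ∀ v, 0 ≤ f₁ v)
    (h₂ : ∀ v, 0 ≤ f₂ v)
    (hint₁ : Integrable (fun q : PairDir => hardSphereKernel q.1 q.2 * (f₁ q.1.1 * f₁ q.1.2)) pairDirMeasure)
    (hint₂ : Integrable (fun q : PairDir => hardSphereKernel q.1 q.2 * (f₂ q.1.1 * f₂ q.1.2)) pairDirMeasure)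
    (hZ₁ : 0 < fluxZ f₁) :
    hellDiss f₁ - hellDiss f₂ ≤
      (|fluxZ f₂ - fluxZ f₁| + 2 * Real.sqrt (2 * lossDist f₁ f₂ * fluxZ f₂) + 2 * lossDist f₁ f₂) / fluxZ f₁ := by
  set N₁ := hellNum f₁ with hN₁
  set N₂ := hellNum f₂ with hN₂
  set D := lossDist f₁ f₂ with hD
  set Z₁ := fluxZ f₁ with hZ₁def
  set Z₂ := fluxZ f₂ with hZ₂def
  have hN₁0 : 0 ≤ N₁ := hellNum_nonneg f₁
  have hN₂0 : 0 ≤ N₂ := hellNum_nonneg f₂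
  have hD0 : 0 ≤ D := lossDist_nonneg f₁ f₂
  have hZ₂0 : 0 ≤ Z₂ := DVTransfer.fluxZ_nonneg h₂
  have hD₂0 : 0 ≤ hellDiss f₂ := DVTransfer.hellDiss_nonneg h₂
  have hD₂1 : hellDiss f₂ ≤ 1 := DVTransfer.hellDiss_le_one hf₂ h₂ hint₂
  -- the triangle inequality, squared
  have htri := sqrt_hellNum_le hf₁ hf₂ h₁ h₂ hint₁ hint₂
  have hsq : N₁ ≤ N₂ + 4 * Real.sqrt D * Real.sqrt N₂ + 4 * D := by
    have hl : 0 ≤ Real.sqrt N₁ := Real.sqrt_nonneg _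
    have hr : 0 ≤ Real.sqrt N₂ + 2 * Real.sqrt D := by positivity
    have h := mul_self_le_mul_self hl htri
    rw [← sq, ← sq, Real.sq_sqrt hN₁0] at h
    have e : (Real.sqrt N₂ + 2 * Real.sqrt D) ^ 2 = N₂ + 4 * Real.sqrt D * Real.sqrt N₂ + 4 * D := by
      rw [add_sq, Real.sq_sqrt hN₂0, mul_pow, Real.sq_sqrt hD0]; ring
    rwa [e] at h
  -- `N₂ = 2 Z₂ 𝒟h₂ ≤ 2 Z₂`
  have hN₂eq : N₂ = 2 * Z₂ * hellDiss f₂ := hellNum_eq hf₂ h₂ hint₂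
  have hN₂le : N₂ ≤ 2 * Z₂ := by
    rw [hN₂eq]; nlinarith [mul_nonneg hZ₂0 (sub_nonneg.2 hD₂1)]
  have hsqrtN₂ : Real.sqrt N₂ ≤ Real.sqrt (2 * Z₂) := Real.sqrt_le_sqrt hN₂le
  have hcross : Real.sqrt D * Real.sqrt N₂ ≤ Real.sqrt (2 * D * Z₂) := by
    have e : Real.sqrt (2 * D * Z₂) = Real.sqrt D * Real.sqrt (2 * Z₂) := by
      rw [show 2 * D * Z₂ = D * (2 * Z₂) by ring, Real.sqrt_mul hD0]
    rw [e]
    exact mul_le_mul_of_nonneg_left hsqrtN₂ (Real.sqrt_nonneg D)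
  -- `𝒟h₁ Z₁ = N₁ / 2`
  have hD₁ : hellDiss f₁ * Z₁ = N₁ / 2 := by
    rw [hellDiss_eq_hellNum, ← hN₁, ← hZ₁def]
    field_simp
  have habs : hellDiss f₂ * Z₂ - hellDiss f₂ * Z₁ ≤ |Z₂ - Z₁| := by
    rcases le_or_gt 0 (Z₂ - Z₁) with h | h
    · rw [abs_of_nonneg h]; nlinarith [mul_nonneg hD₂0 h, mul_le_of_le_one_left h hD₂1]
    · rw [abs_of_neg h]
      have h' : 0 ≤ Z₁ - Z₂ := by linarith
      nlinarith [mul_nonneg hD₂0 h', mul_le_of_le_one_left h' hD₂1]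
  rw [le_div_iff₀ hZ₁, sub_mul, hD₁]
  have hstep : N₁ / 2 ≤ hellDiss f₂ * Z₂ + 2 * Real.sqrt (2 * D * Z₂) + 2 * D := by
    have e2 : N₂ / 2 = hellDiss f₂ * Z₂ := by rw [hN₂eq]; ring
    nlinarith [hsq, hcross, e2, Real.sqrt_nonneg D, Real.sqrt_nonneg N₂]
  nlinarith [hstep, habs, Real.sqrt_nonneg (2 * D * Z₂)]

end ContactToMass

/-- Registration anchor of this helper file (`--supports stmt-AtomisticToContinuum-14868`, stub
`stub_contactToMass`, file 7): the one-sided modulus of the normalised Hellinger dissipation through the loss distance —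
the `∀`-closed form of `ContactToMass.hellDiss_sub_le_of_lossDist`. -/
theorem bhContactToMass_modulusLoss_anchor : ∀ (f₁ f₂ : V3 → ℝ), Measurable f₁ → Measurable f₂ →
    (∀ v, 0 ≤ f₁ v) → (∀ v, 0 ≤ f₂ v) →
    Integrable (fun q : PairDir => hardSphereKernel q.1 q.2 * (f₁ q.1.1 * f₁ q.1.2)) pairDirMeasure →
    Integrable (fun q : PairDir => hardSphereKernel q.1 q.2 * (f₂ q.1.1 * f₂ q.1.2)) pairDirMeasure →
    0 < fluxZ f₁ →
      hellDiss f₁ - hellDiss f₂ ≤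
        (|fluxZ f₂ - fluxZ f₁| + 2 * Real.sqrt (2 * ContactToMass.lossDist f₁ f₂ * fluxZ f₂) +
          2 * ContactToMass.lossDist f₁ f₂) / fluxZ f₁ :=
  fun _ _ hf₁ hf₂ h₁ h₂ hint₁ hint₂ hZ₁ => ContactToMass.hellDiss_sub_le_of_lossDist hf₁ hf₂ h₁ h₂ hint₁ hint₂ hZ₁

end

end Summit.AtomisticToContinuum.HydrodynamicLimit.Theorems.BlockHDissipation
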